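import Summits.QuantumFields.BalabanUV.Beta.FP.GhostMixTwoLeg
import Summits.QuantumFields.BalabanUV.Beta.FP.FineSplitJunctionMajorant

/-!
# `Beta/FP/GhostMixGammaTwoLeg` — road «FP» (binder row D1), row KER-γ (α2) sub-row **α2-c** «GHOST», THE (MIX-1) GHOST WORD IN THE JUNCTION's TWO-LEG
# MAJORANT CURRENCY (ruling R-FP-36 (b); owner l.28436 «(hk) product shape OR (Mκ) windowed-majorant shape, per piece»): per `(c, e)` entry a POINTWISE
# majorant `κ` + its windowed majorant letter (Mκ) of `FineSplitJunctionMajorant.coarse_secondMoment_abs_of_majorant_twoLeg` ∕ `rem_of_majorant` (F′) — the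
# majorant route keeps the one-leg engine's FIELD-SIDE letter (M̃Γ) (`Ã ≍ ℓ₀·N⁻²·Σp`); the product shape of F would pay the `Γ` leg by its sup and lose `N²`

HONEST DEPENDENCY (page 1, mandatory): continuum YM on T⁴ ⇐ BetaPertH ∧ nine spine estimates (0/9 proved); BetaPertH ⇐ (D1) ∧ (D4) ∧
CAP+tail; G-an2-4 gates asym, D1 and NE2/3/4.  HONEST FRAMING (cell contract, verbatim): «discharging `BetaPertH` makes Bałaban's UV
stability UNCONDITIONAL — a real constructive-QFT result; it is NOT the continuum limit and NOT the Clay problem.»  THIS MODULE is [folklore] lattice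
bookkeeping on `ℤ⁴`: `MixLoopPowerCountingMassGamma.abs_mix1_le_vertexMass` and `windowedMajorant_mix1_le` RE-KEYED with TWO vertex families (`q̇₁` at `b` in the
vertex mass letter (M), `q̇₂` at `b′` in the field-side letter (M̃Γ)) over the same helpers BY NAME (`profile_weight_le`, `MixLoopPowerCountingGamma.sum_comm₄`); the
bond-letter instance of (M̃Γ) (`GhostLoopCountingMixGamma.fieldWindowedMass_scl_le`, letter type `Pt`, re-done at `Pt × Fin 4`); `GhostMixTwoLeg.windowedMass_bond_le`
((M), p253304); `GhostLoopCountingMix.ghostColumn_engineLetters` is NOT needed (the (MIX-1) word has no inner minimiser leg: its legs are the coarse two-point `𝔊`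
between the two roots and the fine two-point `Γ` between the two field points, both ABSTRACT with DISPLAYED letters (G₀) sup ∕ (Γ) profile at the window rate —
exactly as in the one-leg END `GhostLoopCountingMixGamma.ghost_mix1_rem`).  It asserts nothing about Bałaban's constrained objects, cites nothing, mints no `Prop`
fact, has no `def`, 0 sorry.  NOT α2-c PART 2, NOT the instances of `𝔊`∕`Γ` ((LEDGER-gh)), NOT hsplit, NOT D1, NOT BetaPertH, NOT continuum, NOT Clay.

ABSOLUTE RULE (cell charter, verbatim): «No internally-minted statement may enter as a cited fact. Every hypothesis is either kernel-proved in this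
package or a verbatim quotation of a PUBLISHED theorem with page reference. The manuscript(s) under audit are NOT citable for their own disputed
steps — they are the thing under adjudication; programme-internal (2001/route/tribunal) claims are never citable.»

CONTENT ([folklore]∕[our object]): §1 **`abs_mix1_twoLeg_le_vertexMass`**, **`windowedMajorant_mix1_twoLeg_le`** (abstract, two families); §2 **`sum_sum_ker₁_bond_le`**,
**`fieldWindowedMass_bond_le`** ((M̃Γ) for the direction-`e` vertex mass of the bond-letter family); §3 **`ghost_mix1_twoLeg`** (∃ κ with (κ) ∧ (Mκ), bound displayed),
**`ghost_mix1_secondMoment_twoLeg`** (F′'s core BY NAME, ANY two outer legs).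
Provenance: D1 formalisation swarm LEAF PROVER 05, unit `b2b-balaban-beta-d1-formalise-leaf-05` gen 15, 2026-08-21, road FP row KER-γ (α2) sub-row α2-c (owner GO
R-FP-35 (a), words l.28227 ∕ l.28436; R-FP-36 (b)); «not in print; our bookkeeping»; no existing file touched.
-/

noncomputable section

namespace Summit.QuantumFields.BalabanUV.Beta.FP.GhostMixGammaTwoLeg

open Finset Real
open scoped BigOperators
open Literature.MathematicalPhysics.QuantumFieldTheory.Balaban1983to89
open Literature.MathematicalPhysics.QuantumFieldTheory.Balaban1983to89.Beta
open DyadicShell (Pt supNorm)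
open AxialBlockWeights (fineBlock)
open Summit.QuantumFields.BalabanUV.Beta.FP.AveragingJetLettersRooted (ker₁ wfld ker₁_nonneg sum_ker₁_le_mul_wfld)
open Summit.QuantumFields.BalabanUV.Beta.FP.ScalarAveragingJetLetters
open Summit.QuantumFields.BalabanUV.Beta.FP.MixLoopPowerCounting (supNorm_cast_nonneg)
open Summit.QuantumFields.BalabanUV.Beta.FP.MixLoopPowerCountingGamma (sum_comm₄)
open Summit.QuantumFields.BalabanUV.Beta.FP.MixLoopPowerCountingMassGamma (profile_weight_le)
open Summit.QuantumFields.BalabanUV.Beta.FP.MixLoopInstanceBlockFamilyField (sum_profile_half_le)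
open Summit.QuantumFields.BalabanUV.Beta.FP.GhostLoopCountingMixGamma (sum_wfld_scl_le)
open Summit.QuantumFields.BalabanUV.Beta.FP.GhostMixTwoLeg (windowedMass_bond_le)
open Summit.QuantumFields.BalabanUV.Beta.FP.FineSplitJunctionMajorant (coarse_secondMoment_abs_of_majorant_twoLeg)

/-! ## §1 The (MIX-1) pointwise shape and windowed majorant with two vertex families -/

section Abstract

variable {U : Pt → Finset Pt} {W : Finset Pt} {qd₁ qd₂ : Pt → Pt → Pt → ℝ} {G Γ : Pt → Pt → ℝ} {C_G C_Γ A_M Ã δ : ℝ} {n R : ℕ}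

/-- **(MIX-1) BY THE VERTEX SUM WITH THE LEG MASSES INLINE, TWO VERTEX FAMILIES** [folklore]: under the plain sup letter `|G| ≤ C_G`,
`|Σ_{u∈U b}Σ_{u′∈U b′} G u′ u·Σ_{w,w′∈W} q̇₁(u;b,b+w)·Γ(b+w,b′+w′)·q̇₂(u′;b′,b′+w′)| ≤ C_G·Σ_{w,w′}|Γ(b+w,b′+w′)|·(Σ_{u∈U b}|q̇₁(u;b,b+w)|)·(Σ_{u′∈U b′}|q̇₂(u′;b′,b′+w′)|)`
(`MixLoopPowerCountingMassGamma.abs_mix1_le_vertexMass` is the case `q̇₁ = q̇₂`). -/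
theorem abs_mix1_twoLeg_le_vertexMass (hG : ∀ u u', |G u u'| ≤ C_G) (b b' : Pt) :
    |∑ u ∈ U b, ∑ u' ∈ U b', G u' u *
        ∑ w ∈ W, ∑ w' ∈ W, qd₁ u b (b + w) * Γ (b + w) (b' + w') * qd₂ u' b' (b' + w')|
      ≤ C_G * ∑ w ∈ W, ∑ w' ∈ W, |Γ (b + w) (b' + w')| *
          ((∑ u ∈ U b, |qd₁ u b (b + w)|) * (∑ u' ∈ U b', |qd₂ u' b' (b' + w')|)) := by
  have hCG : 0 ≤ C_G := (abs_nonneg _).trans (hG b b)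
  have h1 : |∑ u ∈ U b, ∑ u' ∈ U b', G u' u *
        ∑ w ∈ W, ∑ w' ∈ W, qd₁ u b (b + w) * Γ (b + w) (b' + w') * qd₂ u' b' (b' + w')|
      ≤ ∑ u ∈ U b, ∑ u' ∈ U b', ∑ w ∈ W, ∑ w' ∈ W,
          C_G * (|qd₁ u b (b + w)| * |Γ (b + w) (b' + w')| * |qd₂ u' b' (b' + w')|) := by
    refine (Finset.abs_sum_le_sum_abs _ _).trans (Finset.sum_le_sum fun u _ =>
      (Finset.abs_sum_le_sum_abs _ _).trans (Finset.sum_le_sum fun u' _ => ?_))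
    rw [abs_mul]
    refine (mul_le_mul (hG u' u) ((Finset.abs_sum_le_sum_abs _ _).trans (Finset.sum_le_sum fun w _ =>
      Finset.abs_sum_le_sum_abs _ _)) (abs_nonneg _) hCG).trans (le_of_eq ?_)
    rw [Finset.mul_sum]
    refine Finset.sum_congr rfl fun w _ => ?_
    rw [Finset.mul_sum]
    exact Finset.sum_congr rfl fun w' _ => by rw [abs_mul, abs_mul]
  have h2 : ∑ u ∈ U b, ∑ u' ∈ U b', ∑ w ∈ W, ∑ w' ∈ W,
          C_G * (|qd₁ u b (b + w)| * |Γ (b + w) (b' + w')| * |qd₂ u' b' (b' + w')|)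
      = C_G * ∑ w ∈ W, ∑ w' ∈ W, |Γ (b + w) (b' + w')| *
          ((∑ u ∈ U b, |qd₁ u b (b + w)|) * (∑ u' ∈ U b', |qd₂ u' b' (b' + w')|)) := by
    rw [sum_comm₄, Finset.mul_sum]
    refine Finset.sum_congr rfl fun w _ => ?_
    rw [Finset.mul_sum]
    refine Finset.sum_congr rfl fun w' _ => ?_
    rw [Finset.sum_mul_sum, Finset.mul_sum, Finset.mul_sum]
    refine Finset.sum_congr rfl fun u _ => ?_
    rw [Finset.mul_sum, Finset.mul_sum]
    exact Finset.sum_congr rfl fun u' _ => by ring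
  exact h1.trans (le_of_eq h2)

/-- **THE WINDOWED MAJORANT OF (MIX-1), TWO VERTEX FAMILIES** [folklore]: from the reference vertex's mass letter (M) on `q̇₁`
`Σ_{b∈S} e^{−(δ∕(2n))‖b−n•v₀‖∞}·Σ_{u∈U b}Σ_{w∈W}|q̇₁(u;b,b+w)| ≤ A_M` and the running vertex's FIELD-SIDE letter (M̃Γ) on `q̇₂`
`∀ c, Σ_{b′∈S}Σ_{w′∈W} ((‖c−(b′+w′)‖∞+1)⁻² + n⁻²)·e^{−(δ∕(2n))‖c−(b′+w′)‖∞}·Σ_{u′∈U b′}|q̇₂(u′;b′,b′+w′)| ≤ Ã`, with (G₀) `|G| ≤ C_G`, (Γ) `|Γ c c′| ≤ C_Γ(‖c−c′‖∞+1)⁻²e^{−(δ∕n)‖c−c′‖∞}`,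
(W) `‖w‖∞ ≤ R·n`: for `κ₁(b,b′) := C_G·Σ_{w,w′}|Γ(b+w,b′+w′)|·m₁(b,w)·m₂(b′,w′)`,
`Σ_{b,b′∈S} e^{−(δ∕(2n))‖b−n•v₀‖∞}(1+(‖b′−b‖∞∕n)²)·κ₁(b,b′) ≤ C_G·C_Γ(3+8R²)·Ã·A_M` — `windowedMajorant_mix1_le`'s proof (`profile_weight_le` BY NAME) re-keyed. -/
theorem windowedMajorant_mix1_twoLeg_le (hδ : 0 < δ) (hn : 1 ≤ n) (hW : ∀ w ∈ W, supNorm w ≤ R * n) (hG : ∀ u u', |G u u'| ≤ C_G)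
    (hΓ : ∀ c c', |Γ c c'| ≤ C_Γ / ((supNorm (c - c') : ℝ) + 1) ^ 2 * Real.exp (-(δ / n) * (supNorm (c - c') : ℝ)))
    (S : Finset Pt) (v₀ : Pt)
    (hMt : ∀ c : Pt, ∑ b' ∈ S, ∑ w' ∈ W, (1 / ((supNorm (c - (b' + w')) : ℝ) + 1) ^ 2 + ((n : ℝ) ^ 2)⁻¹) *
        Real.exp (-(δ / (2 * n)) * (supNorm (c - (b' + w')) : ℝ)) * (∑ u' ∈ U b', |qd₂ u' b' (b' + w')|) ≤ Ã)
    (hM : ∑ b ∈ S, Real.exp (-(δ / (2 * n)) * (supNorm (b - (n : ℤ) • v₀) : ℝ)) * (∑ u ∈ U b, ∑ w ∈ W, |qd₁ u b (b + w)|) ≤ A_M) :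
    ∑ b ∈ S, ∑ b' ∈ S, Real.exp (-(δ / (2 * n)) * (supNorm (b - (n : ℤ) • v₀) : ℝ)) * (1 + ((supNorm (b' - b) : ℝ) / n) ^ 2) *
        (C_G * ∑ w ∈ W, ∑ w' ∈ W, |Γ (b + w) (b' + w')| *
          ((∑ u ∈ U b, |qd₁ u b (b + w)|) * (∑ u' ∈ U b', |qd₂ u' b' (b' + w')|)))
      ≤ C_G * (C_Γ * (3 + 8 * (R : ℝ) ^ 2)) * Ã * A_M := by
  have hCG : 0 ≤ C_G := (abs_nonneg _).trans (hG v₀ v₀)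
  have hCΓ : 0 ≤ C_Γ := by
    have h := hΓ v₀ v₀
    rw [sub_self, show supNorm (0 : Pt) = 0 from
      Literature.MathematicalPhysics.QuantumFieldTheory.Balaban1983to89.Beta.DyadicShell.supNorm_eq_zero_iff.mpr rfl] at h
    norm_num at h
    exact (abs_nonneg _).trans h
  set m₁ : Pt → Pt → ℝ := fun b w => ∑ u ∈ U b, |qd₁ u b (b + w)| with hm₁
  set m₂ : Pt → Pt → ℝ := fun b w => ∑ u ∈ U b, |qd₂ u b (b + w)| with hm₂
  have hm₁0 : ∀ b w, 0 ≤ m₁ b w := fun b w => Finset.sum_nonneg fun u _ => abs_nonneg _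
  have hm₂0 : ∀ b w, 0 ≤ m₂ b w := fun b w => Finset.sum_nonneg fun u _ => abs_nonneg _
  set E : Pt → ℝ := fun b => Real.exp (-(δ / (2 * n)) * (supNorm (b - (n : ℤ) • v₀) : ℝ)) with hE
  set ω : Pt → Pt → Pt → ℝ := fun c b' w' => (1 / ((supNorm (c - (b' + w')) : ℝ) + 1) ^ 2 + ((n : ℝ) ^ 2)⁻¹) *
      Real.exp (-(δ / (2 * n)) * (supNorm (c - (b' + w')) : ℝ)) with hω
  set K : ℝ := C_Γ * (3 + 8 * (R : ℝ) ^ 2) with hK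
  have hK0 : 0 ≤ K := by positivity
  have hÃ : 0 ≤ Ã := le_trans (Finset.sum_nonneg fun b' _ => Finset.sum_nonneg fun w' _ => by positivity) (hMt v₀)
  -- for fixed `b`: the `b′`-sum against the field-point window
  have hinner : ∀ b ∈ S, ∑ b' ∈ S, (1 + ((supNorm (b' - b) : ℝ) / n) ^ 2) *
      (C_G * ∑ w ∈ W, ∑ w' ∈ W, |Γ (b + w) (b' + w')| * (m₁ b w * m₂ b' w'))
        ≤ C_G * K * Ã * ∑ w ∈ W, m₁ b w := by
    intro b _
    have h1 : ∀ b' ∈ S, (1 + ((supNorm (b' - b) : ℝ) / n) ^ 2) *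
        (C_G * ∑ w ∈ W, ∑ w' ∈ W, |Γ (b + w) (b' + w')| * (m₁ b w * m₂ b' w'))
          ≤ C_G * K * ∑ w ∈ W, m₁ b w * ∑ w' ∈ W, ω (b + w) b' w' * m₂ b' w' := by
      intro b' _
      have key : ∀ w ∈ W, ∀ w' ∈ W, (1 + ((supNorm (b' - b) : ℝ) / n) ^ 2) * (C_G * (|Γ (b + w) (b' + w')| * (m₁ b w * m₂ b' w')))
          ≤ C_G * (K * (m₁ b w * (ω (b + w) b' w' * m₂ b' w'))) := by
        intro w hw w' hw'
        have hp := profile_weight_le (Γ := Γ) hδ hn hW hΓ (b := b) (b' := b') hw hw'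
        have h0 : 0 ≤ m₁ b w * m₂ b' w' := mul_nonneg (hm₁0 b w) (hm₂0 b' w')
        calc (1 + ((supNorm (b' - b) : ℝ) / n) ^ 2) * (C_G * (|Γ (b + w) (b' + w')| * (m₁ b w * m₂ b' w')))
            = C_G * ((|Γ (b + w) (b' + w')| * (1 + ((supNorm (b' - b) : ℝ) / n) ^ 2)) * (m₁ b w * m₂ b' w')) := by ring
          _ ≤ C_G * ((K * ω (b + w) b' w') * (m₁ b w * m₂ b' w')) := by
              refine mul_le_mul_of_nonneg_left (mul_le_mul_of_nonneg_right (hp.trans (le_of_eq ?_)) h0) hCG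
              rw [hK, hω]; ring
          _ = C_G * (K * (m₁ b w * (ω (b + w) b' w' * m₂ b' w'))) := by ring
      calc (1 + ((supNorm (b' - b) : ℝ) / n) ^ 2) * (C_G * ∑ w ∈ W, ∑ w' ∈ W, |Γ (b + w) (b' + w')| * (m₁ b w * m₂ b' w'))
          = ∑ w ∈ W, ∑ w' ∈ W, (1 + ((supNorm (b' - b) : ℝ) / n) ^ 2) * (C_G * (|Γ (b + w) (b' + w')| * (m₁ b w * m₂ b' w'))) := by
            rw [Finset.mul_sum, Finset.mul_sum]
            exact Finset.sum_congr rfl fun w _ => by rw [Finset.mul_sum, Finset.mul_sum]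
        _ ≤ ∑ w ∈ W, ∑ w' ∈ W, C_G * (K * (m₁ b w * (ω (b + w) b' w' * m₂ b' w'))) :=
            Finset.sum_le_sum fun w hw => Finset.sum_le_sum fun w' hw' => key w hw w' hw'
        _ = C_G * K * ∑ w ∈ W, m₁ b w * ∑ w' ∈ W, ω (b + w) b' w' * m₂ b' w' := by
            rw [Finset.mul_sum]
            refine Finset.sum_congr rfl fun w _ => ?_
            rw [Finset.mul_sum, Finset.mul_sum]
            exact Finset.sum_congr rfl fun w' _ => by ring
    calc _ ≤ ∑ b' ∈ S, C_G * K * ∑ w ∈ W, m₁ b w * ∑ w' ∈ W, ω (b + w) b' w' * m₂ b' w' := Finset.sum_le_sum h1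
      _ = C_G * K * ∑ w ∈ W, m₁ b w * ∑ b' ∈ S, ∑ w' ∈ W, ω (b + w) b' w' * m₂ b' w' := by
          rw [← Finset.mul_sum, Finset.sum_comm]
          congr 1
          refine Finset.sum_congr rfl fun w _ => ?_
          rw [Finset.mul_sum]
      _ ≤ C_G * K * ∑ w ∈ W, m₁ b w * Ã := by
          refine mul_le_mul_of_nonneg_left (Finset.sum_le_sum fun w _ => mul_le_mul_of_nonneg_left ?_ (hm₁0 b w)) (by positivity)
          have h := hMt (b + w)
          simpa only [hω, hm₂] using h
      _ = C_G * K * Ã * ∑ w ∈ W, m₁ b w := by rw [← Finset.sum_mul]; ring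
  calc _ = ∑ b ∈ S, E b * ∑ b' ∈ S, (1 + ((supNorm (b' - b) : ℝ) / n) ^ 2) *
          (C_G * ∑ w ∈ W, ∑ w' ∈ W, |Γ (b + w) (b' + w')| * (m₁ b w * m₂ b' w')) := by
        refine Finset.sum_congr rfl fun b _ => ?_
        rw [Finset.mul_sum]
        exact Finset.sum_congr rfl fun b' _ => by ring
    _ ≤ ∑ b ∈ S, E b * (C_G * K * Ã * ∑ w ∈ W, m₁ b w) :=
        Finset.sum_le_sum fun b hb => mul_le_mul_of_nonneg_left (hinner b hb) (Real.exp_pos _).le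
    _ = C_G * K * Ã * ∑ b ∈ S, E b * ∑ w ∈ W, m₁ b w := by
        rw [Finset.mul_sum]; exact Finset.sum_congr rfl fun b _ => by ring
    _ ≤ C_G * K * Ã * A_M := by
        refine mul_le_mul_of_nonneg_left ?_ (by positivity)
        have e : ∀ b, ∑ w ∈ W, m₁ b w = ∑ u ∈ U b, ∑ w ∈ W, |qd₁ u b (b + w)| := fun b => by rw [hm₁]; exact Finset.sum_comm
        simpa only [hE, e] using hM
    _ = C_G * (C_Γ * (3 + 8 * (R : ℝ) ^ 2)) * Ã * A_M := by rw [hK]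

end Abstract

/-! ## §2 The field-side letter (M̃Γ) of the bond-letter 0-form family -/

section Bond

variable {σ : Type*} [Fintype σ] {N : ℕ} {p : σ → ℝ} {rad : σ → Pt → Pt → List (Pt × Fin 4)} {ℓ₀ R₀ : ℕ}

/-- [folklore] **THE ALL-BLOCKS FIELD-SIDE MASS of the bond-letter family, direction `e`**: `Σ_{u∈Y} Σ_{b∈S} ker₁^{(u)} (b,e) c ≤ ℓ₀·N⁻⁴·Σ_σ p σ` for every finite
`Y`, `S` and every field point `c` (`sum_ker₁_le_mul_wfld` per block on the bond window `S × {e}`, then `GhostLoopCountingMixGamma.sum_wfld_scl_le` — the field-point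
count does not see the letters). -/
theorem sum_sum_ker₁_bond_le (hN : 1 ≤ N) (hp : ∀ s, 0 ≤ p s) (hrad : ∀ s u x', (rad s u x').length ≤ ℓ₀)
    (Y S : Finset Pt) (e : Fin 4) (c : Pt) :
    ∑ u ∈ Y, ∑ b ∈ S, ker₁ (sclW N p) (sclFld N u) (sclBg N u rad) (b, e) c ≤ ((ℓ₀ : ℕ) : ℝ) * (((N : ℝ) ^ 4)⁻¹ * ∑ s, p s) := by
  have hblk : ∀ u, ∑ b ∈ S, ker₁ (sclW N p) (sclFld N u) (sclBg N u rad) (b, e) c ≤ ((ℓ₀ : ℕ) : ℝ) * wfld (sclW N p) (sclFld N u) c := by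
    intro u
    have h := sum_ker₁_le_mul_wfld (sclW_nonneg N hp) (length_sclBg_le u (hrad · u ·))
      (S.map ⟨fun b => (b, e), fun x y h => congrArg Prod.fst h⟩) c (fld := sclFld N u)
    rw [Finset.sum_map] at h
    exact h
  calc ∑ u ∈ Y, ∑ b ∈ S, ker₁ (sclW N p) (sclFld N u) (sclBg N u rad) (b, e) c
      ≤ ∑ u ∈ Y, ((ℓ₀ : ℕ) : ℝ) * wfld (sclW N p) (sclFld N u) c := Finset.sum_le_sum fun u _ => hblk u
    _ = ((ℓ₀ : ℕ) : ℝ) * ∑ u ∈ Y, wfld (sclW N p) (sclFld N u) c := by rw [Finset.mul_sum]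
    _ ≤ ((ℓ₀ : ℕ) : ℝ) * (((N : ℝ) ^ 4)⁻¹ * ∑ s, p s) := mul_le_mul_of_nonneg_left (sum_wfld_scl_le hN hp Y c) (Nat.cast_nonneg _)

/-- **(M̃Γ) FOR THE BOND-LETTER 0-FORM FAMILY, direction `e`** ([folklore]; ANY coarse windows `U b′`, ANY finite `W`, `S`, every fine centre `c`): with
`m_e(b′,w′) := Σ_{u′∈U b′}|ker₁^{(u′)} (b′,e) (b′+w′)|`,
`Σ_{b′∈S}Σ_{w′∈W} ((‖c−(b′+w′)‖∞+1)⁻² + N⁻²)·e^{−(δ∕(2N))‖c−(b′+w′)‖∞}·m_e(b′,w′) ≤ (ℓ₀·N⁻⁴·Σ_σ p σ)·(((1+80e^{δ∕4}(4∕δ)²) + (1+480e^{δ∕4}(4∕δ)⁴))·N²)`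
— `GhostLoopCountingMixGamma.fieldWindowedMass_scl_le` (letter type `Pt`) re-done with bond letters: reindex the field leg, count the field point ONCE over all blocks
(`sum_sum_ker₁_bond_le`), then the profile window sum (`MixLoopInstanceBlockFamilyField.sum_profile_half_le` BY NAME); `Ã ≍ ℓ₀·N⁻²·Σp`, every power displayed. -/
theorem fieldWindowedMass_bond_le {δ : ℝ} (hδ : 0 < δ) (hN : 1 ≤ N) (hp : ∀ s, 0 ≤ p s)
    (hrad : ∀ s u x', (rad s u x').length ≤ ℓ₀) (U : Pt → Finset Pt) (W S : Finset Pt) (e : Fin 4) (c : Pt) :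
    ∑ b' ∈ S, ∑ w' ∈ W, (1 / ((supNorm (c - (b' + w')) : ℝ) + 1) ^ 2 + ((N : ℝ) ^ 2)⁻¹) *
        Real.exp (-(δ / (2 * N)) * (supNorm (c - (b' + w')) : ℝ)) *
        (∑ u' ∈ U b', |ker₁ (sclW N p) (sclFld N u') (sclBg N u' rad) (b', e) (b' + w')|)
      ≤ (((ℓ₀ : ℕ) : ℝ) * (((N : ℝ) ^ 4)⁻¹ * ∑ s, p s)) *
        (((1 + 80 * Real.exp (δ / 4) * (4 / δ) ^ 2) + (1 + 480 * Real.exp (δ / 4) * (4 / δ) ^ 4)) * (N : ℝ) ^ 2) := by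
  classical
  set Y : Finset Pt := S.biUnion U with hY
  set T : Finset Pt := S.biUnion (fun b' => W.image fun w' => b' + w') with hT
  have hω := sclW_nonneg N hp
  set φ : Pt → ℝ := fun z => (1 / ((supNorm z : ℝ) + 1) ^ 2 + ((N : ℝ) ^ 2)⁻¹) * Real.exp (-(δ / (2 * N)) * (supNorm z : ℝ)) with hφ
  have hφ0 : ∀ z, 0 ≤ φ z := fun z => by rw [hφ]; positivity
  set F : Pt → Pt → ℝ := fun b' c' => φ (c - c') * ∑ u' ∈ Y, ker₁ (sclW N p) (sclFld N u') (sclBg N u' rad) (b', e) c' with hF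
  have hF0 : ∀ b' c', 0 ≤ F b' c' := fun b' c' => mul_nonneg (hφ0 _) (Finset.sum_nonneg fun u' _ => ker₁_nonneg hω _ _)
  -- step 1: `U b′ ⊆ Y`, `|ker₁| = ker₁`
  have hstep1 : ∀ b' ∈ S, ∀ w' ∈ W, (1 / ((supNorm (c - (b' + w')) : ℝ) + 1) ^ 2 + ((N : ℝ) ^ 2)⁻¹) *
        Real.exp (-(δ / (2 * N)) * (supNorm (c - (b' + w')) : ℝ)) *
        (∑ u' ∈ U b', |ker₁ (sclW N p) (sclFld N u') (sclBg N u' rad) (b', e) (b' + w')|) ≤ F b' (b' + w') := by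
    intro b' hb' w' _
    have hUb : U b' ⊆ Y := by rw [hY]; exact Finset.subset_biUnion_of_mem U hb'
    rw [hF]
    refine mul_le_mul_of_nonneg_left ?_ (hφ0 _)
    have habs : ∀ u', |ker₁ (sclW N p) (sclFld N u') (sclBg N u' rad) (b', e) (b' + w')|
        = ker₁ (sclW N p) (sclFld N u') (sclBg N u' rad) (b', e) (b' + w') :=
      fun u' => abs_of_nonneg (ker₁_nonneg hω _ _)
    simp only [habs]
    exact Finset.sum_le_sum_of_subset_of_nonneg hUb fun u' _ _ => ker₁_nonneg hω _ _
  -- step 2: reindex `w′ ↦ c′ = b′ + w′` and enlarge to `T`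
  have hstep2 : ∀ b' ∈ S, ∑ w' ∈ W, F b' (b' + w') ≤ ∑ c' ∈ T, F b' c' := by
    intro b' hb'
    rw [← Finset.sum_image (s := W) (g := fun w' => b' + w') (f := fun c' => F b' c') (fun x _ y _ h => add_left_cancel h)]
    refine Finset.sum_le_sum_of_subset_of_nonneg ?_ fun c' _ _ => hF0 b' c'
    rw [hT]
    exact Finset.subset_biUnion_of_mem (fun b' => W.image fun w' => b' + w') hb'
  -- step 3: swap and count the field point once over all blocks
  have hstep3 : ∑ b' ∈ S, ∑ c' ∈ T, F b' c' ≤ ∑ c' ∈ T, φ (c - c') * (((ℓ₀ : ℕ) : ℝ) * (((N : ℝ) ^ 4)⁻¹ * ∑ s, p s)) := by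
    rw [Finset.sum_comm]
    refine Finset.sum_le_sum fun c' _ => ?_
    have e1 : ∑ b' ∈ S, F b' c' = φ (c - c') * ∑ u' ∈ Y, ∑ b' ∈ S, ker₁ (sclW N p) (sclFld N u') (sclBg N u' rad) (b', e) c' := by
      rw [hF, ← Finset.mul_sum, Finset.sum_comm]
    rw [e1]
    exact mul_le_mul_of_nonneg_left (sum_sum_ker₁_bond_le hN hp hrad Y S e c') (hφ0 _)
  -- step 4: the profile window sum, reindexed `c′ ↦ z = c − c′`
  have hstep4 : ∑ c' ∈ T, φ (c - c')
      ≤ ((1 + 80 * Real.exp (δ / 4) * (4 / δ) ^ 2) + (1 + 480 * Real.exp (δ / 4) * (4 / δ) ^ 4)) * (N : ℝ) ^ 2 := by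
    rw [← Finset.sum_image (s := T) (g := fun c' => c - c') (f := fun z => φ z) (fun x _ y _ h => sub_right_injective h)]
    exact sum_profile_half_le hδ hN _
  have hK0 : 0 ≤ ((ℓ₀ : ℕ) : ℝ) * (((N : ℝ) ^ 4)⁻¹ * ∑ s, p s) := by
    have : 0 ≤ ∑ s, p s := Finset.sum_nonneg fun s _ => hp s
    positivity
  calc ∑ b' ∈ S, ∑ w' ∈ W, (1 / ((supNorm (c - (b' + w')) : ℝ) + 1) ^ 2 + ((N : ℝ) ^ 2)⁻¹) *
          Real.exp (-(δ / (2 * N)) * (supNorm (c - (b' + w')) : ℝ)) *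
          (∑ u' ∈ U b', |ker₁ (sclW N p) (sclFld N u') (sclBg N u' rad) (b', e) (b' + w')|)
      ≤ ∑ b' ∈ S, ∑ w' ∈ W, F b' (b' + w') := Finset.sum_le_sum fun b' hb' => Finset.sum_le_sum fun w' hw' => hstep1 b' hb' w' hw'
    _ ≤ ∑ b' ∈ S, ∑ c' ∈ T, F b' c' := Finset.sum_le_sum hstep2
    _ ≤ ∑ c' ∈ T, φ (c - c') * (((ℓ₀ : ℕ) : ℝ) * (((N : ℝ) ^ 4)⁻¹ * ∑ s, p s)) := hstep3
    _ = (((ℓ₀ : ℕ) : ℝ) * (((N : ℝ) ^ 4)⁻¹ * ∑ s, p s)) * ∑ c' ∈ T, φ (c - c') := by rw [← Finset.sum_mul, mul_comm]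
    _ ≤ _ := mul_le_mul_of_nonneg_left hstep4 hK0

end Bond

/-! ## §3 The ghost (MIX-1) word: a majorant with its windowed letter, and F′'s core by name -/

section Ghost

/-- **`ghost_mix1_twoLeg` — THE GHOST (MIX-1) WORD IN THE TWO-LEG MAJORANT CURRENCY** ([our object]).  For every window rate `δ > 0`, `N ≥ 1`, every 0-form rooted
block family with BOND letters (`p ≥ 0`, word length `≤ ℓ₀`, letters within `R₀N` of the root block), ANY coarse windows `U b` with (U) at `R₀+1`, finite offsets
with (W) at `R₀+1`, an ABSTRACT coarse two-point leg `𝔊` with (G₀) `|𝔊 u u′| ≤ C_G` and an ABSTRACT fine two-point leg `Γ` with (Γ)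
`|Γ c c′| ≤ C_Γ(‖c−c′‖∞+1)⁻²e^{−(δ∕N)‖c−c′‖∞}`: THERE IS a majorant `κ c e b b′` of the `(c, e)` entry
`k₁^{gh,(c,e)}(b,b′) = Σ_{u∈U b}Σ_{u′∈U b′} 𝔊 u′ u·Σ_{w,w′∈W} ker₁^{(u)}(b,c)(b+w)·Γ(b+w,b′+w′)·ker₁^{(u′)}(b′,e)(b′+w′)` (`abs_mix1_twoLeg_le_vertexMass`) whose windowed
majorant letter (Mκ) at every coarse centre `v₀` and fine window `S` is
`≤ C_G·C_Γ(3+8(R₀+1)²)·[(ℓ₀·N⁻⁴·Σp)·(((1+80e^{δ∕4}(4∕δ)²)+(1+480e^{δ∕4}(4∕δ)⁴))·N²)]·[(ℓ₀·Σp)·e^{δR₀∕2}·(e^{δ∕2}(1+480e^{δ∕4}(4∕δ)⁴))]`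
(`windowedMajorant_mix1_twoLeg_le` with (M̃Γ) := `fieldWindowedMass_bond_le`, (M) := `GhostMixTwoLeg.windowedMass_bond_le` BY NAME) — the (hk)(Mκ) binders of F′;
every power of `N` displayed (`N⁻⁴·N²`). -/
theorem ghost_mix1_twoLeg {δ : ℝ} (hδ : 0 < δ) {N : ℕ} (hN : 1 ≤ N)
    {σ : Type*} [Fintype σ] {p : σ → ℝ} (hp : ∀ s, 0 ≤ p s)
    {rad : σ → Pt → Pt → List (Pt × Fin 4)} {ℓ₀ R₀ : ℕ} (hrad : ∀ s u x', (rad s u x').length ≤ ℓ₀)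
    (hradR : ∀ (s : σ) (u : Pt) (x : ↥(fineBlock N)) (ℓ : Pt × Fin 4), ℓ ∈ rad s u x.1 → supNorm (ℓ.1 - (N : ℤ) • u) ≤ R₀ * N)
    (U : Pt → Finset Pt) {W : Finset Pt} (hW : ∀ w ∈ W, supNorm w ≤ (R₀ + 1) * N)
    {G Γ : Pt → Pt → ℝ} {C_G C_Γ : ℝ} (hG : ∀ u u', |G u u'| ≤ C_G)
    (hΓ : ∀ c c', |Γ c c'| ≤ C_Γ / ((supNorm (c - c') : ℝ) + 1) ^ 2 * Real.exp (-(δ / N) * (supNorm (c - c') : ℝ))) :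
    ∃ κ : Fin 4 → Fin 4 → Pt → Pt → ℝ,
      (∀ (c e : Fin 4) (b b' : Pt),
        |∑ u ∈ U b, ∑ u' ∈ U b', G u' u *
            ∑ w ∈ W, ∑ w' ∈ W, ker₁ (sclW N p) (sclFld N u) (sclBg N u rad) (b, c) (b + w) * Γ (b + w) (b' + w') *
              ker₁ (sclW N p) (sclFld N u') (sclBg N u' rad) (b', e) (b' + w')| ≤ κ c e b b') ∧
      (∀ (c e : Fin 4) (v₀ : Pt) (S : Finset Pt),
        ∑ b ∈ S, ∑ b' ∈ S, Real.exp (-(δ / (2 * N)) * (supNorm (b - (N : ℤ) • v₀) : ℝ)) *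
            (1 + ((supNorm (b' - b) : ℝ) / N) ^ 2) * κ c e b b'
          ≤ C_G * (C_Γ * (3 + 8 * ((R₀ : ℝ) + 1) ^ 2)) *
              ((((ℓ₀ : ℕ) : ℝ) * (((N : ℝ) ^ 4)⁻¹ * ∑ s, p s)) *
                (((1 + 80 * Real.exp (δ / 4) * (4 / δ) ^ 2) + (1 + 480 * Real.exp (δ / 4) * (4 / δ) ^ 4)) * (N : ℝ) ^ 2)) *
              ((((ℓ₀ : ℕ) : ℝ) * ∑ s, p s) * Real.exp (δ * R₀ / 2) *
                (Real.exp (δ / 2) * (1 + 480 * Real.exp (δ / 4) * (4 / δ) ^ 4)))) := by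
  refine ⟨fun c e b b' => C_G * ∑ w ∈ W, ∑ w' ∈ W, |Γ (b + w) (b' + w')| *
      ((∑ u ∈ U b, |ker₁ (sclW N p) (sclFld N u) (sclBg N u rad) (b, c) (b + w)|) *
        (∑ u' ∈ U b', |ker₁ (sclW N p) (sclFld N u') (sclBg N u' rad) (b', e) (b' + w')|)), fun c e b b' => ?_, fun c e v₀ S => ?_⟩
  · exact abs_mix1_twoLeg_le_vertexMass (U := U) (W := W)
      (qd₁ := fun u b x => ker₁ (sclW N p) (sclFld N u) (sclBg N u rad) (b, c) x)
      (qd₂ := fun u b x => ker₁ (sclW N p) (sclFld N u) (sclBg N u rad) (b, e) x) (Γ := Γ) hG b b'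
  · have hMt := fun q : Pt => fieldWindowedMass_bond_le hδ hN hp hrad U W S e q
    have hM := windowedMass_bond_le hδ hN hp hrad hradR U W S c ((N : ℤ) • v₀)
    have h := windowedMajorant_mix1_twoLeg_le (n := N) (R := R₀ + 1) (U := U) (W := W)
      (qd₁ := fun u b x => ker₁ (sclW N p) (sclFld N u) (sclBg N u rad) (b, c) x)
      (qd₂ := fun u b x => ker₁ (sclW N p) (sclFld N u) (sclBg N u rad) (b, e) x) hδ hN hW hG hΓ S v₀ hMt hM
    have e1 : (((R₀ + 1 : ℕ) : ℝ)) = (R₀ : ℝ) + 1 := by push_cast; ring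
    rw [e1] at h
    exact h

/-- **`ghost_mix1_secondMoment_twoLeg` — THE GHOST (MIX-1) WORD THROUGH F′'s TWO-LEG MAJORANT CORE** ([our object];
`FineSplitJunctionMajorant.coarse_secondMoment_abs_of_majorant_twoLeg` BY NAME at `ghost_mix1_twoLeg`'s majorant), ANY reference leg `J₁` with (J) at rate `δ∕N`,
anchor `v₀`, running leg `J₂` with (J′), all finite `S`, `V`:
`Σ_{v∈V}‖v−v₀‖∞²·Σ_{b,b′∈S}|J₁ b|·|J₂ b′ v|·|k₁^{gh,(c,e)}(b,b′)| ≤ 3·C_J·C_J′·(1+16∕δ²)·(C_G·C_Γ(3+8(R₀+1)²)·Ã·A_M)` — the one-leg END's number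
(`GhostLoopCountingMixGamma.coarse_mix1_secondMoment_scl`) in the junction's currency. -/
theorem ghost_mix1_secondMoment_twoLeg {δ : ℝ} (hδ : 0 < δ) {N : ℕ} (hN : 1 ≤ N)
    {σ : Type*} [Fintype σ] {p : σ → ℝ} (hp : ∀ s, 0 ≤ p s)
    {rad : σ → Pt → Pt → List (Pt × Fin 4)} {ℓ₀ R₀ : ℕ} (hrad : ∀ s u x', (rad s u x').length ≤ ℓ₀)
    (hradR : ∀ (s : σ) (u : Pt) (x : ↥(fineBlock N)) (ℓ : Pt × Fin 4), ℓ ∈ rad s u x.1 → supNorm (ℓ.1 - (N : ℤ) • u) ≤ R₀ * N)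
    (U : Pt → Finset Pt) {W : Finset Pt} (hW : ∀ w ∈ W, supNorm w ≤ (R₀ + 1) * N)
    {G Γ : Pt → Pt → ℝ} {C_G C_Γ : ℝ} (hG : ∀ u u', |G u u'| ≤ C_G)
    (hΓ : ∀ c c', |Γ c c'| ≤ C_Γ / ((supNorm (c - c') : ℝ) + 1) ^ 2 * Real.exp (-(δ / N) * (supNorm (c - c') : ℝ)))
    (c e : Fin 4) {J₁ : Pt → ℝ} {J₂ : Pt → Pt → ℝ} {C_J C_J' : ℝ} (S V : Finset Pt) (v₀ : Pt)
    (hJ : ∀ b, |J₁ b| ≤ C_J * Real.exp (-(δ / N) * (supNorm (b - (N : ℤ) • v₀) : ℝ)))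
    (hJ' : ∀ b', ∑ v ∈ V, (1 + ((supNorm (b' - (N : ℤ) • v) : ℝ) / N) ^ 2) * |J₂ b' v| ≤ C_J') :
    ∑ v ∈ V, (supNorm (v - v₀) : ℝ) ^ 2 * ∑ b ∈ S, ∑ b' ∈ S, |J₁ b| * |J₂ b' v| *
        |∑ u ∈ U b, ∑ u' ∈ U b', G u' u *
            ∑ w ∈ W, ∑ w' ∈ W, ker₁ (sclW N p) (sclFld N u) (sclBg N u rad) (b, c) (b + w) * Γ (b + w) (b' + w') *
              ker₁ (sclW N p) (sclFld N u') (sclBg N u' rad) (b', e) (b' + w')|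
      ≤ 3 * C_J * C_J' * (1 + 16 / δ ^ 2) *
          (C_G * (C_Γ * (3 + 8 * ((R₀ : ℝ) + 1) ^ 2)) *
              ((((ℓ₀ : ℕ) : ℝ) * (((N : ℝ) ^ 4)⁻¹ * ∑ s, p s)) *
                (((1 + 80 * Real.exp (δ / 4) * (4 / δ) ^ 2) + (1 + 480 * Real.exp (δ / 4) * (4 / δ) ^ 4)) * (N : ℝ) ^ 2)) *
              ((((ℓ₀ : ℕ) : ℝ) * ∑ s, p s) * Real.exp (δ * R₀ / 2) *
                (Real.exp (δ / 2) * (1 + 480 * Real.exp (δ / 4) * (4 / δ) ^ 4)))) := by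
  obtain ⟨κ, hk, hM⟩ := ghost_mix1_twoLeg hδ hN hp hrad hradR U hW hG hΓ
  exact coarse_secondMoment_abs_of_majorant_twoLeg (n := N) (S := S) (V := V) (v₀ := v₀) (J₁ := J₁) (J₂ := J₂)
    (κ := κ c e) hδ hN (fun b b' => hk c e b b') hJ hJ' (hM c e v₀ S)

end Ghost

end Summit.QuantumFields.BalabanUV.Beta.FP.GhostMixGammaTwoLeg

end
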